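/-
Copyright (c) 2026 the pub-hodgecm-mathlib formalisation cell (harness21).  Prover seat hodgecm-mathlib-A-p16 (g29), architect of road «S3-tree»
(ruling A-57 (a) S-b), 2026-09-01.
-/
import Mathlib.Topology.Algebra.ClopenNhdofOne
import Mathlib.Topology.Algebra.OpenSubgroup
import Mathlib.Topology.Algebra.Support
import Mathlib.Topology.LocallyConstant.Basic
import Mathlib.Algebra.BigOperators.Fin
import Mathlib.Tactic.Group
import Literature.Topology.LocallyConstantCompactSupportUniform
import HarnessLib

/-!
# The FINITE CONJUGATION AVERAGE of a locally constant compactly supported function over a compact open subgroup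

Topic `Topology`; namespace `Literature.Topology`.  THEOREMS ONLY (no definition, no instance, no notation, no named fact, no `sorry`); folklore
(Bernstein–Zelevinsky 1976 §1, Cartier 1979 §1.1: `C_c^∞(G)` is stable under averaging over a compact open subgroup, and the average is a FINITE sum).
Cell `pub/hodgecm-mathlib` (D-0151), crux H413 = `stmt-HodgeConjecture-24833`, road «S3-tree» (LEAD F0P3a-plan (g11) WORD T10-2), END CONTRACT v0
(F0P3a-p03 (g14) 8ae112bb) stub «SPAN», architect ruling A-57 (a) organ **S-b «FINITE AD-AVERAGE»**: the pieces of a test function produced by a vertex cover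
must be made `Ad(K)`-invariant WITHOUT changing their orbital integrals; this file supplies the invariant replacement as a finite average of conjugates, so that
no Haar measure on `K` and no Fubini argument is needed downstream (orbital integrals are additive and conjugation-invariant class by class).
HONEST LABEL: HC_CM is proved only modulo the printed citations until rung 0 closes; this file is pure topology and pays no letter.

THE MATHEMATICS.  `G` a topological group, `f : G → 𝕜` locally constant with compact support.  (§1) `f` is uniformly locally constant on BOTH sides (★
`exists_nhds_one_forall_mul_eq_of_hasCompactSupport{,'}`), hence invariant under CONJUGATION by a neighbourhood of `1`, hence by an OPEN SUBGROUP `S`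
(the conjugation-stabiliser of `f` is a subgroup containing a neighbourhood of `1`).  (§2) For a compact open subgroup `K`, the compact group `↥K` has an open
NORMAL subgroup `N ≤ K ∩ S` (Mathlib `IsTopologicalGroup.exist_openNormalSubgroup_sub_clopen_nhds_of_one`) of finite index; `a ↦ f ∘ Ad(a)` is constant on
`N`-cosets, so with representatives `k₁, …, kₙ ∈ K` of `K ∕ N` the finite sum `F := Σ_i f ∘ Ad(k_i)` satisfies `F ∘ Ad(u) = F` for every `u ∈ K` (right
multiplication by `⟦u⟧` permutes `K ∕ N`).  (§3) Bookkeeping: conjugates and finite sums of conjugates are locally constant, compactly supported, and supported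
in `K` when `f` is and the `k_i ∈ K`; the normalised average `(n : 𝕜)⁻¹ • F` as well (`n ≥ 1`).

* §1 `exists_nhds_one_forall_conj_eq_of_hasCompactSupport`, `exists_open_subgroup_forall_conj_eq_of_hasCompactSupport`.
* §2 **`exists_finset_conj_sum_invariant_of_hasCompactSupport`** (the finite family `k : Fin n → G`, `0 < n`, `k i ∈ K`, `Σ_i f (k_i (u x u⁻¹) k_i⁻¹) = Σ_i f (k_i x k_i⁻¹)`).
* §3 `isLocallyConstant_conj`, `hasCompactSupport_conj`, `tsupport_conj_subset`, `isLocallyConstant_sum_conj`, `hasCompactSupport_sum_conj`, `tsupport_sum_conj_subset`,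
  and the packaged head **`exists_conj_average_of_hasCompactSupport`** (an `Ad(K)`-invariant locally constant compactly supported `F`, supported in `K` if `f` is,
  which is `(n : 𝕜)⁻¹ • Σ_i f ∘ Ad(k_i)` with all `k_i ∈ K`).

## References
* [BernsteinZelevinsky1976] I. N. Bernstein, A. V. Zelevinsky, *Representations of the group GL(n, F) where F is a non-archimedean local field*, Russian Math.
  Surveys 31 (1976): §1.1–§1.2 (locally constant compactly supported functions; averaging over compact open subgroups).
* [CartierCorvallis1979] P. Cartier, *Representations of p-adic groups: a survey*, Proc. Sympos. Pure Math. 33 Part 1 (1979): §1.1 p. 112.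
-/

set_option autoImplicit false

open Topology Filter Set

namespace Literature.Topology

variable {G : Type*} [Group G] [TopologicalSpace G] [IsTopologicalGroup G] {Y : Type*}

/-! ## §1 Conjugation invariance under an open subgroup -/

section ConjStabiliser

variable [Zero Y]

/-- A locally constant compactly supported function on a topological group is invariant under CONJUGATION by a neighbourhood of `1`:
`∃ V ∈ 𝓝 1, ∀ v ∈ V, ∀ x, f (v * x * v⁻¹) = f x` (combine the right and left uniform local constancy). [cite: BernsteinZelevinsky1976, §1.1] -/
theorem exists_nhds_one_forall_conj_eq_of_hasCompactSupport {f : G → Y} (hf : IsLocallyConstant f) (hfs : HasCompactSupport f) :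
    ∃ V ∈ 𝓝 (1 : G), ∀ v ∈ V, ∀ x : G, f (v * x * v⁻¹) = f x := by
  obtain ⟨V₁, hV₁, h₁⟩ := exists_nhds_one_forall_mul_eq_of_hasCompactSupport hf hfs
  obtain ⟨V₂, hV₂, h₂⟩ := exists_nhds_one_forall_mul_eq_of_hasCompactSupport' hf hfs
  refine ⟨V₁⁻¹ ∩ V₂, Filter.inter_mem (inv_mem_nhds_one G hV₁) hV₂, fun v hv x => ?_⟩
  have hv₁ : v⁻¹ ∈ V₁ := hv.1
  rw [h₁ (v * x) v⁻¹ hv₁, h₂ x v hv.2]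

/-- The CONJUGATION STABILISER of a locally constant compactly supported `f` contains an OPEN SUBGROUP: `∃ S : Subgroup G, IsOpen S ∧ ∀ s ∈ S, ∀ x,
f (s * x * s⁻¹) = f x` (the stabiliser `{s | f ∘ Ad(s) = f}` is a subgroup containing a neighbourhood of `1`). [cite: BernsteinZelevinsky1976, §1.1] -/
theorem exists_open_subgroup_forall_conj_eq_of_hasCompactSupport {f : G → Y} (hf : IsLocallyConstant f) (hfs : HasCompactSupport f) :
    ∃ S : Subgroup G, IsOpen (S : Set G) ∧ ∀ s ∈ S, ∀ x : G, f (s * x * s⁻¹) = f x := by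
  obtain ⟨V, hV, hVf⟩ := exists_nhds_one_forall_conj_eq_of_hasCompactSupport hf hfs
  let S : Subgroup G :=
    { carrier := {s | ∀ x : G, f (s * x * s⁻¹) = f x}
      mul_mem' := by
        intro a b ha hb x
        have : a * b * x * (a * b)⁻¹ = a * (b * x * b⁻¹) * a⁻¹ := by group
        rw [Set.mem_setOf_eq] at ha hb
        rw [this, ha, hb]
      one_mem' := by
        intro x
        simp
      inv_mem' := by
        intro a ha x
        rw [Set.mem_setOf_eq] at ha
        have := ha (a⁻¹ * x * a⁻¹⁻¹)
        rw [inv_inv] at this ⊢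
        have h2 : a * (a⁻¹ * x * a) * a⁻¹ = x := by group
        rw [h2] at this
        exact this.symm }
  refine ⟨S, Subgroup.isOpen_of_mem_nhds S (Filter.mem_of_superset hV fun v hv => hVf v hv), fun s hs x => hs x⟩

end ConjStabiliser

/-! ## §2 The finite invariant sum of conjugates over a compact open subgroup -/

section FiniteSum

variable [AddCommMonoid Y]

/-- **THE FINITE `Ad(K)`-INVARIANT SUM OF CONJUGATES.**  `K` a compact subgroup (openness is not needed here), `f` locally constant with compact support.  There are finitely many
`k₁, …, kₙ ∈ K` (`n ≥ 1`; representatives of `K ∕ N` for an open normal subgroup `N` of `K` conjugating `f` to itself) such that `F x := Σ_i f (k_i x k_i⁻¹)` is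
invariant under conjugation by every `u ∈ K`: `F (u x u⁻¹) = F x`. [cite: BernsteinZelevinsky1976, §1.2] [cite: CartierCorvallis1979, §1.1 p. 112] -/
theorem exists_finset_conj_sum_invariant_of_hasCompactSupport {K : Subgroup G} (hKc : IsCompact (K : Set G))
    {f : G → Y} (hf : IsLocallyConstant f) (hfs : HasCompactSupport f) :
    ∃ (n : ℕ) (k : Fin n → G), 0 < n ∧ (∀ i, k i ∈ K) ∧
      ∀ u ∈ K, ∀ x : G, ∑ i, f (k i * (u * x * u⁻¹) * (k i)⁻¹) = ∑ i, f (k i * x * (k i)⁻¹) := by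
  classical
  obtain ⟨S, hSo, hSf⟩ := exists_open_subgroup_forall_conj_eq_of_hasCompactSupport hf hfs
  -- the compact group `↥K` and the clopen neighbourhood `K ∩ S` of its identity
  haveI : CompactSpace K := isCompact_iff_compactSpace.1 hKc
  let W : Set K := ((↑) : K → G) ⁻¹' (S : Set G)
  have hWo : IsOpen W := hSo.preimage continuous_subtype_val
  have hWc : IsClosed W := (Subgroup.isClosed_of_isOpen S hSo).preimage continuous_subtype_val
  have h1W : (1 : K) ∈ W := by
    change ((1 : K) : G) ∈ (S : Set G)
    rw [Subgroup.coe_one]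
    exact S.one_mem
  obtain ⟨N, hN⟩ := IsTopologicalGroup.exist_openNormalSubgroup_sub_clopen_nhds_of_one ⟨hWc, hWo⟩ h1W
  -- the finite quotient `Q = K ∕ N`
  haveI : Finite (K ⧸ N.toSubgroup) := Subgroup.quotient_finite_of_isOpen N.toSubgroup N.isOpen
  haveI : Fintype (K ⧸ N.toSubgroup) := Fintype.ofFinite _
  let e := Fintype.equivFin (K ⧸ N.toSubgroup)
  -- representatives
  let k : Fin (Fintype.card (K ⧸ N.toSubgroup)) → G := fun i => ((Quotient.out (e.symm i) : K) : G)
  refine ⟨Fintype.card (K ⧸ N.toSubgroup), k, ?_, fun i => (Quotient.out (e.symm i)).2, fun u hu x => ?_⟩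
  · haveI : Nonempty (K ⧸ N.toSubgroup) := ⟨((1 : K) : K ⧸ N.toSubgroup)⟩
    exact Fintype.card_pos
  · -- the class function `a ↦ f (a x a⁻¹)` on `K` descends to `Q`
    have hdesc : ∀ y : G, ∀ a b : K, (a : K ⧸ N.toSubgroup) = (b : K ⧸ N.toSubgroup) →
        f ((a : G) * y * (a : G)⁻¹) = f ((b : G) * y * (b : G)⁻¹) := by
      intro y a b hab
      rw [QuotientGroup.eq] at hab
      -- `a⁻¹ b ∈ N`, so `b = a n` with `n ∈ N ⊆ S`-preimage; conjugation by `a n a⁻¹ ∈ N` fixes `f`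
      have hn : (a⁻¹ * b : K) ∈ N := hab
      have hconj : (a * (a⁻¹ * b) * a⁻¹ : K) ∈ N := N.isNormal'.conj_mem _ hn a
      have hS : (((a * (a⁻¹ * b) * a⁻¹ : K)) : G) ∈ (S : Set G) := hN hconj
      have key := hSf _ hS ((a : G) * y * (a : G)⁻¹)
      have hcalc : (((a * (a⁻¹ * b) * a⁻¹ : K)) : G) * ((a : G) * y * (a : G)⁻¹) * ((((a * (a⁻¹ * b) * a⁻¹ : K)) : G))⁻¹ =
          (b : G) * y * (b : G)⁻¹ := by
        simp only [Subgroup.coe_mul, Subgroup.coe_inv]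
        group
      rw [hcalc] at key
      exact key.symm
    -- the descended function
    let g : G → (K ⧸ N.toSubgroup) → Y := fun y => Quotient.lift (fun a : K => f ((a : G) * y * (a : G)⁻¹))
      (fun a b hab => hdesc y a b (Quotient.sound hab))
    have hg : ∀ y : G, ∀ a : K, g y (a : K ⧸ N.toSubgroup) = f ((a : G) * y * (a : G)⁻¹) := fun y a => rfl
    have hsum : ∀ y : G, ∑ i, f (k i * y * (k i)⁻¹) = ∑ q : K ⧸ N.toSubgroup, g y q := by
      intro y
      rw [← e.symm.sum_comp]
      refine Fintype.sum_congr _ _ fun i => ?_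
      change f (((Quotient.out (e.symm i) : K) : G) * y * (((Quotient.out (e.symm i) : K) : G))⁻¹) = g y (e.symm i)
      conv_rhs => rw [← QuotientGroup.out_eq' (e.symm i)]
      exact (hg y _).symm
    rw [hsum, hsum]
    -- right multiplication by `⟦u⟧` permutes `Q`
    let uK : K := ⟨u, hu⟩
    have hshift : ∀ q : K ⧸ N.toSubgroup, g (u * x * u⁻¹) q = g x (q * (uK : K ⧸ N.toSubgroup)) := by
      intro q
      induction q using QuotientGroup.induction_on with
      | H a =>
        rw [← QuotientGroup.mk_mul, hg, hg]
        congr 1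
        simp only [Subgroup.coe_mul, uK]
        group
    simp_rw [hshift]
    exact Fintype.sum_equiv (Equiv.mulRight (uK : K ⧸ N.toSubgroup)) _ _ fun q => rfl

end FiniteSum

/-! ## §3 Bookkeeping: conjugates, finite sums of conjugates, the normalised average -/

section Bookkeeping

/-- A conjugate `x ↦ f (k x k⁻¹)` of a locally constant function is locally constant. [cite: BernsteinZelevinsky1976, §1.1] -/
theorem isLocallyConstant_conj {f : G → Y} (hf : IsLocallyConstant f) (k : G) : IsLocallyConstant fun x => f (k * x * k⁻¹) :=
  hf.comp_continuous ((continuous_const.mul continuous_id).mul continuous_const)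

/-- A conjugate `x ↦ f (k x k⁻¹)` of a compactly supported function is compactly supported. [cite: BernsteinZelevinsky1976, §1.1] -/
theorem hasCompactSupport_conj [Zero Y] {f : G → Y} (hfs : HasCompactSupport f) (k : G) : HasCompactSupport fun x => f (k * x * k⁻¹) := by
  have h := hfs.comp_homeomorph ((Homeomorph.mulLeft k).trans (Homeomorph.mulRight k⁻¹))
  have heq : (fun x => f (k * x * k⁻¹)) = f ∘ ⇑((Homeomorph.mulLeft k).trans (Homeomorph.mulRight k⁻¹)) := by
    funext x
    simp only [Function.comp_apply, Homeomorph.trans_apply, Homeomorph.coe_mulLeft, Homeomorph.coe_mulRight]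
  rw [heq]
  exact h

/-- If `tsupport f ⊆ K` (a subgroup) and `k ∈ K` then `tsupport (f ∘ Ad k) ⊆ K`. [cite: BernsteinZelevinsky1976, §1.1] -/
theorem tsupport_conj_subset [Zero Y] {f : G → Y} {K : Subgroup G} (hK : IsOpen (K : Set G)) (hfK : tsupport f ⊆ (K : Set G)) {k : G} (hk : k ∈ K) :
    tsupport (fun x => f (k * x * k⁻¹)) ⊆ (K : Set G) := by
  -- `K` is clopen, so it suffices to control the support
  have hKc : IsClosed (K : Set G) := Subgroup.isClosed_of_isOpen K hK
  refine (closure_minimal (fun x hx => ?_) hKc)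
  have hx' : k * x * k⁻¹ ∈ (K : Set G) := hfK (subset_tsupport f hx)
  have : x = k⁻¹ * (k * x * k⁻¹) * k := by group
  rw [this]
  exact K.mul_mem (K.mul_mem (K.inv_mem hk) hx') hk

variable [AddCommMonoid Y]

/-- A finite sum of conjugates of a locally constant function is locally constant. [cite: BernsteinZelevinsky1976, §1.1] -/
theorem isLocallyConstant_sum_conj {f : G → Y} (hf : IsLocallyConstant f) {n : ℕ} (k : Fin n → G) :
    IsLocallyConstant fun x => ∑ i, f (k i * x * (k i)⁻¹) := by
  classical
  have : ∀ s : Finset (Fin n), IsLocallyConstant fun x => ∑ i ∈ s, f (k i * x * (k i)⁻¹) := by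
    intro s
    induction s using Finset.induction_on with
    | empty =>
      simp only [Finset.sum_empty]
      exact IsLocallyConstant.const 0
    | insert i s hi ih =>
      simp only [Finset.sum_insert hi]
      exact (isLocallyConstant_conj hf (k i)).add ih
  exact this Finset.univ

/-- A finite sum of conjugates of a compactly supported function is compactly supported. [cite: BernsteinZelevinsky1976, §1.1] -/
theorem hasCompactSupport_sum_conj {f : G → Y} (hfs : HasCompactSupport f) {n : ℕ} (k : Fin n → G) :
    HasCompactSupport fun x => ∑ i, f (k i * x * (k i)⁻¹) := by
  classical
  have : ∀ s : Finset (Fin n), HasCompactSupport fun x => ∑ i ∈ s, f (k i * x * (k i)⁻¹) := by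
    intro s
    induction s using Finset.induction_on with
    | empty =>
      simp only [Finset.sum_empty]
      exact HasCompactSupport.zero
    | insert i s hi ih =>
      simp only [Finset.sum_insert hi]
      exact (hasCompactSupport_conj hfs (k i)).add ih
  exact this Finset.univ

/-- If `tsupport f ⊆ K` (an open subgroup) and all `k_i ∈ K`, the finite sum of conjugates is supported in `K`. [cite: BernsteinZelevinsky1976, §1.1] -/
theorem tsupport_sum_conj_subset {f : G → Y} {K : Subgroup G} (hK : IsOpen (K : Set G)) (hfK : tsupport f ⊆ (K : Set G))
    {n : ℕ} {k : Fin n → G} (hk : ∀ i, k i ∈ K) :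
    tsupport (fun x => ∑ i, f (k i * x * (k i)⁻¹)) ⊆ (K : Set G) := by
  classical
  have hKc : IsClosed (K : Set G) := Subgroup.isClosed_of_isOpen K hK
  refine closure_minimal (fun x hx => ?_) hKc
  rw [Function.mem_support] at hx
  by_contra hxK
  apply hx
  refine Finset.sum_eq_zero fun i _ => ?_
  have hi : x ∉ tsupport (fun y => f (k i * y * (k i)⁻¹)) := fun h => hxK (tsupport_conj_subset hK hfK (hk i) h)
  exact image_eq_zero_of_notMem_tsupport (f := fun y => f (k i * y * (k i)⁻¹)) hi

end Bookkeeping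

/-! ## §4 The packaged head: an `Ad(K)`-invariant average with the same shape -/

section Head

variable {𝕜 : Type*} [DivisionRing 𝕜]

/-- **THE `Ad(K)`-INVARIANT FINITE AVERAGE.**  `K` a compact open subgroup of a topological group `G`, `f : G → 𝕜` locally constant with compact support.
There are `n ≥ 1` and `k₁, …, kₙ ∈ K` such that the AVERAGE `F x := (n : 𝕜)⁻¹ • Σ_i f (k_i x k_i⁻¹)` is locally constant, compactly supported, `Ad(K)`-invariant
(`F (u x u⁻¹) = F x` for `u ∈ K`), and supported in `K` whenever `f` is.  In characteristic `0` any functional that is additive and invariant under conjugation by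
elements of `K` (an orbital integral at a class where it is additive) takes the same value on `F` as on `f`: `F` is an average of `n` `K`-conjugates of `f`
(no `CharZero` hypothesis is needed for the properties stated here).
[cite: BernsteinZelevinsky1976, §1.2] [cite: CartierCorvallis1979, §1.1 p. 112] -/
theorem exists_conj_average_of_hasCompactSupport {K : Subgroup G} (hKo : IsOpen (K : Set G)) (hKc : IsCompact (K : Set G))
    {f : G → 𝕜} (hf : IsLocallyConstant f) (hfs : HasCompactSupport f) :
    ∃ (n : ℕ) (k : Fin n → G), 0 < n ∧ (∀ i, k i ∈ K) ∧
      IsLocallyConstant (fun x => (n : 𝕜)⁻¹ * ∑ i, f (k i * x * (k i)⁻¹)) ∧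
      HasCompactSupport (fun x => (n : 𝕜)⁻¹ * ∑ i, f (k i * x * (k i)⁻¹)) ∧
      (∀ u ∈ K, ∀ x : G, (n : 𝕜)⁻¹ * ∑ i, f (k i * (u * x * u⁻¹) * (k i)⁻¹) = (n : 𝕜)⁻¹ * ∑ i, f (k i * x * (k i)⁻¹)) ∧
      (tsupport f ⊆ (K : Set G) → tsupport (fun x => (n : 𝕜)⁻¹ * ∑ i, f (k i * x * (k i)⁻¹)) ⊆ (K : Set G)) := by
  obtain ⟨n, k, hn, hk, hinv⟩ := exists_finset_conj_sum_invariant_of_hasCompactSupport hKc hf hfs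
  refine ⟨n, k, hn, hk, ?_, ?_, fun u hu x => by rw [hinv u hu x], fun hfK => ?_⟩
  · exact (IsLocallyConstant.const ((n : 𝕜)⁻¹)).mul (isLocallyConstant_sum_conj hf k)
  · exact (hasCompactSupport_sum_conj hfs k).mul_left
  · exact (tsupport_mul_subset_right (f := fun _ => (n : 𝕜)⁻¹) (g := fun x => ∑ i, f (k i * x * (k i)⁻¹))).trans
      (tsupport_sum_conj_subset hKo hfK hk)

end Head

end Literature.Topology
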